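import Literature.AlgebraicGeometry.HodgeTheory.CMCurveTimesSimpleCMSurfaceStablyNondegenerate
import HarnessLib

/-!
# A simple CM abelian surface: no non-zero `y ∈ F⁻` of the CM field has rational square (Moonen–Zarhin 1999 (5.10): «`F₁` does not contain an imaginary quadratic field»)

Family `hodge`, layer `Literature/AlgebraicGeometry/HodgeTheory`. Research context: cell `pub-hodge-ring2`
(HONEST FRAMING: research route conditional on HC_CM; not a corollary; Q11.4-sentence-2 already refuted in
dim ≥ 3), Literature lane, programme R28b (Moonen–Zarhin 1999 (5.10): `S × T`, `S` a simple CM surface): the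
supplier of hypothesis (NOSQ) of `Motives/HodgeThetaAnnihilatorRankOneCentreTimesQSimpleTorus` and of the
hypothesis `y₁² ∉ ℚ` of `NumberTheory/ComplexMultiplication/QuarticCMUnitaryTorusQSimple`. Theorems only (no
definition, no named fact, no `sorry`).

* §1 `exists_quadratic_cmType_ringHom_of_mul_self_eq` (number theory): in a number field `K` with a complex
  embedding under which `y` is purely imaginary, a non-zero `y` with `y² = r ∈ ℚ` generates an IMAGINARY QUADRATIC
  subfield `ℚ(y) ↪ K` carrying a CM type (`r < 0`; `minpoly y = X² - r`; the two embeddings of `ℚ(y)` are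
  interchanged by complex conjugation).
* §2 `mul_self_ne_algebraMap_of_isSimple_of_isCMTypeRealisation`: for a SIMPLE abelian surface `A` realising a CM
  type of the quartic CM field `K`, no non-zero `y ∈ K⁻` (`ȳ = -y`) has `y² ∈ ℚ` — by §1 and the tree's
  `isEmpty_ringHom_of_isSimple_of_isCMTypeRealisation` («the center of `End⁰(X₂)` does not contain an imaginary
  quadratic field», Moonen–Zarhin (5.2); «as `F₁` does not contain an imaginary quadratic field», (5.10)).

## References

* [MoonenZarhin1999LowDim] B. Moonen, Yu. Zarhin, Math. Ann. 315 (1999), (5.2), (5.10) (held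
  `paper:arxiv-math_9901113` pp. 8, 10). [cite: MoonenZarhin1999LowDim, §5 (5.10)]
* [Shimura1998] G. Shimura, *Abelian Varieties with Complex Multiplication and Modular Functions* (1998), §8.4
  Example (2), §18.2 (1). [cite: Shimura1998, §8.4 Example (2)]
-/

noncomputable section

open Module NumberField Polynomial IntermediateField

namespace Literature.AlgebraicGeometry.HodgeTheory

open Literature.AlgebraicGeometry.Motives (AbelianVariety CMType)
open Literature.AlgebraicGeometry.ComplexMultiplication (IsCMTypeRealisation)

/-! ### §1 An imaginary quadratic subfield from a purely imaginary element of rational square -/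

section Quadratic

variable {K : Type} [Field K] [NumberField K]

/-- A complex number with `conj z = -z` and `z ≠ 0` has negative real square `z² = -(im z)²`. [folklore] -/
private theorem re_mul_self_lt_zero_of_conj_eq_neg {z : ℂ} (hz : starRingEnd ℂ z = -z) (hz0 : z ≠ 0) :
    (z * z).re < 0 ∧ (z * z).im = 0 := by
  have hre : z.re = 0 := by
    have h := congrArg Complex.re hz
    rw [Complex.conj_re, Complex.neg_re] at h
    linarith
  have him : z.im ≠ 0 := by
    intro h0
    exact hz0 (Complex.ext (by rw [hre, Complex.zero_re]) (by rw [h0, Complex.zero_im]))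
  refine ⟨?_, ?_⟩
  · rw [Complex.mul_re, hre, zero_mul, zero_sub, neg_lt_zero]
    exact mul_self_pos.2 him
  · rw [Complex.mul_im, hre, zero_mul, mul_zero, add_zero]

/-- **An element `y ≠ 0`, purely imaginary at one complex embedding, with `y² = r ∈ ℚ`, generates an imaginary
quadratic subfield carrying a CM type**: `r < 0`, `ℚ(y) ≅ ℚ[X]/(X² - r)` has degree `2`, its two complex
embeddings take `y` to `±i√(-r)` and are interchanged by complex conjugation, so `{φ₀}` is a CM type of `ℚ(y)`;
the inclusion `ℚ(y) ↪ K` is the ring homomorphism. (Shimura §18.2 (1): `K = ℚ(√-α)`, `α` totally positive.)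
[cite: Shimura1998, §18.2 (1)] [cite: MoonenZarhin1999LowDim, §5 (5.10)] -/
theorem exists_quadratic_cmType_ringHom_of_mul_self_eq (σ : K →+* ℂ) {y : K}
    (hys : starRingEnd ℂ (σ y) = -σ y) (hy0 : y ≠ 0) {r : ℚ} (hr : y * y = algebraMap ℚ K r) :
    ∃ (k : Type) (_ : Field k) (_ : NumberField k) (_ : CMType k), Module.finrank ℚ k = 2 ∧ Nonempty (k →+* K) := by
  classical
  -- `r < 0`
  have hσy0 : σ y ≠ 0 := fun h => hy0 (σ.injective (by rw [h, map_zero]))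
  have hσr : σ y * σ y = (r : ℂ) := by rw [← map_mul, hr, eq_ratCast, map_ratCast]
  have hr0 : r < 0 := by
    have h := (re_mul_self_lt_zero_of_conj_eq_neg hys hσy0).1
    rw [hσr, Complex.ratCast_re] at h
    exact_mod_cast h
  -- `minpoly y = X² - r`, `[ℚ(y) : ℚ] = 2`
  have hint : IsIntegral ℚ y := .of_finite ℚ y
  have hirr : Irreducible (X ^ 2 - C r : ℚ[X]) := by
    refine (X_pow_sub_C_irreducible_iff_of_prime Nat.prime_two).2 fun b hb => ?_
    nlinarith [sq_nonneg b]
  have hmin : minpoly ℚ y = X ^ 2 - C r := by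
    have hmonic : (X ^ 2 - C r : ℚ[X]).Monic := monic_X_pow_sub_C _ two_ne_zero
    have haeval : aeval y (X ^ 2 - C r : ℚ[X]) = 0 := by
      rw [map_sub, map_pow, aeval_X, aeval_C, sq, hr, sub_self]
    exact (minpoly.eq_of_irreducible_of_monic hirr haeval hmonic).symm
  have hdeg : Module.finrank ℚ ℚ⟮y⟯ = 2 := by
    rw [adjoin.finrank hint, hmin, natDegree_X_pow_sub_C]
  -- the subfield `k = ℚ(y)`, its element `y`, and the embedding `φ₀ = σ|_k`
  set k := ℚ⟮y⟯ with hk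
  set yk : k := AdjoinSimple.gen ℚ y with hyk
  have hyk_coe : (algebraMap k K) yk = y := AdjoinSimple.algebraMap_gen ℚ y
  have hyk2 : yk * yk = algebraMap ℚ k r := (algebraMap k K).injective (by
    rw [map_mul, hyk_coe, hr]
    exact IsScalarTower.algebraMap_apply ℚ k K r)
  -- every embedding of `k` is purely imaginary non-zero at `yk`, hence not fixed by conjugation
  have hφ : ∀ φ : k →+* ℂ, ComplexEmbedding.conjugate φ ≠ φ := by
    intro φ hφ
    have hφr : φ yk * φ yk = (r : ℂ) := by rw [← map_mul, hyk2, eq_ratCast, map_ratCast]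
    have hconj : starRingEnd ℂ (φ yk) = φ yk := by
      have h := congrArg (fun ψ : k →+* ℂ => ψ yk) hφ
      simpa only [ComplexEmbedding.conjugate_coe_eq] using h
    -- `φ yk` is real with square `r < 0`: impossible
    have him : (φ yk).im = 0 := by
      have h := congrArg Complex.im hconj
      rw [Complex.conj_im] at h
      linarith
    have hre : (φ yk * φ yk).re = (φ yk).re * (φ yk).re := by rw [Complex.mul_re, him, mul_zero, sub_zero]
    rw [hφr, Complex.ratCast_re] at hre
    have h0 : (0 : ℝ) ≤ (φ yk).re * (φ yk).re := mul_self_nonneg _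
    have hr0' : ((r : ℝ)) < 0 := by exact_mod_cast hr0
    linarith
  -- exactly two embeddings: `φ₀` and `φ̄₀`
  set φ₀ : k →+* ℂ := σ.comp (algebraMap k K) with hφ₀
  have hcard : Fintype.card (k →+* ℂ) = 2 := by rw [Embeddings.card, hdeg]
  have htwo : ∀ φ : k →+* ℂ, φ = φ₀ ∨ φ = ComplexEmbedding.conjugate φ₀ := by
    intro φ
    by_contra! h
    have h3 : ({φ, φ₀, ComplexEmbedding.conjugate φ₀} : Finset (k →+* ℂ)).card = 3 := by
      rw [Finset.card_insert_of_notMem, Finset.card_insert_of_notMem, Finset.card_singleton]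
      · rw [Finset.mem_singleton]; exact (hφ φ₀).symm
      · simp only [Finset.mem_insert, Finset.mem_singleton, not_or]; exact ⟨h.1, h.2⟩
    have hle := Finset.card_le_univ ({φ, φ₀, ComplexEmbedding.conjugate φ₀} : Finset (k →+* ℂ))
    rw [h3, hcard] at hle
    omega
  -- the CM type `{φ₀}`
  refine ⟨k, inferInstance, inferInstance, ⟨{φ₀}, fun φ => ?_⟩, hdeg, ⟨(algebraMap k K : k →+* K)⟩⟩
  simp only [Set.mem_singleton_iff]
  constructor
  · rintro rfl h
    exact hφ _ h
  · intro h
    rcases htwo φ with h1 | h1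
    · exact h1
    · exfalso
      apply h
      rw [h1, ComplexEmbedding.involutive_conjugate]

end Quadratic

/-! ### §2 A simple CM surface: `y² ∉ ℚ` for every non-zero `y ∈ K⁻` -/

section Surface

variable {K : Type} [Field K] [NumberField K] [IsCMField K] {Φ : CMType K} {A : AbelianVariety ℂ}
  {ι : 𝓞 K →+* CategoryTheory.End A} {θ : K →+* Module.End ℂ (complexBetti A.X 1)}

/-- **For a SIMPLE abelian surface with complex multiplication by the quartic CM field `K`, no non-zero `y ∈ K⁻`
has rational square** — otherwise `ℚ(y) ⊆ K` would be an imaginary quadratic subfield (§1), which a simple CM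
surface forbids (the tree's `isEmpty_ringHom_of_isSimple_of_isCMTypeRealisation`: an embedded quadratic CM field
makes every CM type of `K` imprimitive, Shimura §8.4 (2)(A)). Moonen–Zarhin (5.10): «as `F₁` does not contain an
imaginary quadratic field»; (5.2): «the center of `End⁰(X₂)` does not contain an imaginary quadratic field».
[cite: MoonenZarhin1999LowDim, §5 (5.10)] [cite: Shimura1998, §8.4 Example (2)] -/
theorem mul_self_ne_algebraMap_of_isSimple_of_isCMTypeRealisation (hK : Module.finrank ℚ K = 4)
    (hA : IsCMTypeRealisation Φ A ι θ) (hs : A.IsSimple) {y : K} (hys : IsCMField.complexConj K y = -y)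
    (hy0 : y ≠ 0) (r : ℚ) : y * y ≠ algebraMap ℚ K r := by
  intro hr
  obtain ⟨σ⟩ : Nonempty (K →+* ℂ) := inferInstance
  have hσ : starRingEnd ℂ (σ y) = -σ y := by
    rw [← IsCMField.complexEmbedding_complexConj, hys, map_neg]
  obtain ⟨k, _, _, Φk, hk2, ⟨e⟩⟩ := exists_quadratic_cmType_ringHom_of_mul_self_eq σ hσ hy0 hr
  exact (isEmpty_ringHom_of_isSimple_of_isCMTypeRealisation Φk hk2 hK hA hs).false e

end Surface

end Literature.AlgebraicGeometry.HodgeTheory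

end
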